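import Summits.BirchSwinnertonDyer.BirchSwinnertonDyer.Theorems.SignedBaseChangeAnticyclotomicEisensteinDivisibilityFinitePieceDescent
import HarnessLib

/-!
# The kernel of `res : H¹(K_∞^{(1)}, M) → H¹(K̃_∞, M)` is finite (helper for crux
# `AnticyclotomicEisensteinDivisibility`, stmt-BirchSwinnertonDyer-20727, line `bdpline`, stub `stub_finitePieceSS`)

Second ingredient of the two-step descent over the `ℤ_p²`-tower (sibling of `…FinitePieceDescent.lean`):
for a finite discrete `Γ_K`-module `M` with open stabilisers and a generator pair `(γ₁, γ₂)` of
`(κ₁, κ₂)`, the kernel of restriction from `N₁ = ker κ₁` to `N₂ = pairKer κ₁ κ₂` is finite — a kernel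
class has a cocycle vanishing on `N₂` (subtract the coboundary), and such a cocycle is determined by
its value at `γ₂ ∈ N₁`: its zero set against another such cocycle is an open subgroup of `N₁`
containing `N₂` and `γ₂`, hence all of `N₁` (`eq_top_of_isOpen_of_subgroupOf_pairKer_le`). So the
kernel injects into the finite `M`. This is `H¹(N₁/N₂, M^{N₂}) ↪ M` (Serre, *Galois Cohomology*,
I.§2.6) without the inflation map. BSD is not proved by any of this.
-/

-- D-0017: single-problem summit, the namespace repeats the problem name by design.
set_option linter.dupNamespace false
set_option autoImplicit false

open Literature.NumberTheory.EllipticCurves Literature.NumberTheory.GaloisRepresentations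

namespace Summit.BirchSwinnertonDyer.BirchSwinnertonDyer.Theorems.SignedBaseChangeAcDivFinitePiece

universe u

variable {K : Type u} [Field K] {p : ℕ} [Fact p.Prime]
  {κ₁ κ₂ : ZpExtension K p} {γ₁ γ₂ : Field.absoluteGaloisGroup K}
  {M : Type u} [AddCommGroup M] [DistribMulAction (Field.absoluteGaloisGroup K) M]
  [TopologicalSpace M] [DiscreteTopology M]

/-- **The kernel of restriction `H¹(K_∞^{(1)}, M) → H¹(K̃_∞, M)` is finite** for a finite discrete
`M`: a kernel class is represented by a cocycle `c` on `N₁` vanishing on `N₂` (subtract the coboundary),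
and such a `c` is determined by `c(γ₂) ∈ M` — on `N₂ γ₂ᵏ` by the cocycle rule, on all of `N₁` by
continuity and density (`pairKer` and `γ₂` topologically generate `ker κ₁`). So the kernel injects into
`M`. (This is `H¹(N₁/N₂, M^{N₂}) ↪ M`, Serre I.§2.6, without the inflation map.)
[cite: SerreGaloisCohomology1997, I.§2.6 (b)] -/
theorem finite_ker_resOfLe_pair [Finite M] (hγ : ZpExtension.IsTopGeneratorPair κ₁ κ₂ γ₁ γ₂)
    (hstab : ∀ v : M, IsOpen ((MulAction.stabilizer (Field.absoluteGaloisGroup K) v : Subgroup _) :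
      Set (Field.absoluteGaloisGroup K))) :
    Set.Finite ((resOfLe M (ZpExtension.pairKer_le_left κ₁ κ₂)).ker :
      Set (subgroupH1 κ₁.kerSubgroup M)) := by
  classical
  haveI := compactSpace_kerSubgroup κ₁
  let N₁ : Subgroup (Field.absoluteGaloisGroup K) := κ₁.kerSubgroup
  let N : Subgroup N₁ := (ZpExtension.pairKer κ₁ κ₂).subgroupOf κ₁.kerSubgroup
  let γ : N₁ := ⟨γ₂, mem_kerSubgroup_of_pair hγ⟩
  -- every kernel class has a cocycle vanishing on `N₂`
  have hrep : ∀ y ∈ (resOfLe M (ZpExtension.pairKer_le_left κ₁ κ₂)).ker,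
      ∃ ψ : contOneCocycles (discreteTopRep N₁ M), oneCocycleClass _ ψ = y ∧ ∀ h ∈ N, ψ.1 h = 0 := by
    intro y hy
    obtain ⟨φ, rfl⟩ := oneCocycleClass_surjective _ y
    have hmap : resOfLe M (ZpExtension.pairKer_le_left κ₁ κ₂) (oneCocycleClass _ φ) = oneCocycleClass _
        (contOneCocycles.pullback (subgroupInclusion (ZpExtension.pairKer_le_left κ₁ κ₂))
          (resHomOfEquivariant (subgroupInclusion (ZpExtension.pairKer_le_left κ₁ κ₂)) (AddMonoidHom.id M)
            (fun _ _ ↦ rfl)) φ) :=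
      map_oneCocycleClass _ _ _ φ
    rw [AddMonoidHom.mem_ker, hmap, oneCocycleClass_eq_zero_iff] at hy
    obtain ⟨b, hb⟩ := hy
    refine ⟨φ - cobCocycle b ?_, ?_, ?_⟩
    · show Continuous fun g : N₁ ↦ (g : Field.absoluteGaloisGroup K) • b
      exact (continuous_smul_of_isOpen_stabilizer b (hstab b)).comp continuous_subtype_val
    · rw [oneCocycleClass_sub, oneCocycleClass_cobCocycle, sub_zero]
    · intro h hh
      have := hb ⟨h, Subgroup.mem_subgroupOf.mp hh⟩
      rw [contOneCocycles.pullback_apply] at this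
      change φ.1 h = _ at this
      change φ.1 h - ((h : N₁) • b - b) = 0
      rw [this]
      exact sub_self _
  choose! rep hrep_eq hrep_zero using hrep
  -- the value at `γ₂` determines the normalised cocycle
  have hdet : ∀ ψ ψ' : contOneCocycles (discreteTopRep N₁ M), (∀ h ∈ N, ψ.1 h = 0) → (∀ h ∈ N, ψ'.1 h = 0) →
      ψ.1 γ = ψ'.1 γ → ψ = ψ' := by
    intro ψ ψ' h0 h0' hγγ
    -- the difference vanishes on `N` and at `γ`, hence on the subgroup they generate
    set δ := ψ - ψ' with hδ
    have hδN : ∀ h ∈ N, δ.1 h = 0 := fun h hh ↦ by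
      rw [hδ, Submodule.coe_sub, ContinuousMap.sub_apply, h0 h hh, h0' h hh, sub_zero]
    have hδγ : δ.1 γ = 0 := by rw [hδ, Submodule.coe_sub, ContinuousMap.sub_apply, hγγ, sub_self]
    -- the zero set of `δ` is a subgroup containing `N` and `γ`, and it is open (δ locally constant) — so it is everything
    let Z : Subgroup N₁ :=
      { carrier := {g | δ.1 g = 0}
        one_mem' := contOneCocycles.apply_one δ
        mul_mem' := fun {a b} ha hb ↦ by
          show δ.1 (a * b) = 0
          rw [δ.2 a b]
          change δ.1 a + a • δ.1 b = 0
          rw [ha, hb, smul_zero, add_zero]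
        inv_mem' := fun {a} ha ↦ by
          show δ.1 a⁻¹ = 0
          have := δ.2 a⁻¹ a
          rw [inv_mul_cancel, contOneCocycles.apply_one] at this
          change (0 : M) = δ.1 a⁻¹ + a⁻¹ • δ.1 a at this
          rw [ha, smul_zero, add_zero] at this
          exact this.symm }
    have hZopen : IsOpen (Z : Set N₁) := by
      -- `Z` contains the open neighbourhood `{g | δ g = 0}` of every point of itself: it IS that set
      exact (isOpen_discrete ({0} : Set M)).preimage δ.1.continuous
    have hZ : Z = ⊤ := eq_top_of_isOpen_of_subgroupOf_pairKer_le hγ Z hZopen (fun h hh ↦ hδN h hh) hδγ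
    apply Subtype.ext
    ext g
    have : g ∈ Z := hZ ▸ Subgroup.mem_top g
    have hg : δ.1 g = 0 := this
    rw [hδ, Submodule.coe_sub, ContinuousMap.sub_apply, sub_eq_zero] at hg
    exact hg
  -- conclude: `y ↦ (rep y)(γ)` is injective on the kernel, with values in the finite `M`
  refine Set.Finite.of_finite_image (Set.toFinite _) (f := fun y ↦ (rep y).1 γ) ?_
  intro y hy y' hy' hyy
  have := hdet (rep y) (rep y') (hrep_zero y hy) (hrep_zero y' hy') hyy
  rw [← hrep_eq y hy, ← hrep_eq y' hy', this]


end Summit.BirchSwinnertonDyer.BirchSwinnertonDyer.Theorems.SignedBaseChangeAcDivFinitePiece
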